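import Summits.BirchSwinnertonDyer.BirchSwinnertonDyer.Theorems.ResidualThetaTransportAtTwoResidualSignedLambdaLowerCMAtTwoStationE
import Summits.BirchSwinnertonDyer.BirchSwinnertonDyer.Theorems.ResidualThetaTransportAtTwoKatoZetaDefs
import HarnessLib

/-!
# stub-ideation k3 · g27 (technique: decomposition) — TRIVIALISATION RIGIDITY and the COEFFICIENTWISE GAUGE of station (R)

Crux `ResidualThetaCountLowerPureAtTwo` (stmt-BirchSwinnertonDyer-26074), stub `stub_cmLambdaLower` (= RSL_g, stmt-22608), skeleton
`Lines/bt26_lambda.lean` v7; one level down: line «onepair» v3f, registered KERNEL stub `stub_kzgValueRelation` = station (R) (the print-adjacent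
port «`KatoValuedClass` ⟹ `C ν · e(𝒸 z) = μt · Lm · u`»). SKETCH ONLY: no `def` / instance / notation / axiom; `sorry` only inside the two
residual sub-stubs `stub_*` of §B. BSD is NOT proved by any of this; 26074 / 22608 / 24105 stay OPEN / HOLD.

THE MOVE. Station (R) quantifies over EVERY additive `Λ`-semilinear trivialisation `e : Λⁿ ≃+ Λ_𝒪` with `e (𝒸 (s • x)) = s · e (𝒸 x)` on `Λ_𝒪 z`.
(TR) **Trivialisation rigidity** (PROVED, `trivialisation_rigidity`): for two such `e, e′` one has `e′ (𝒸 z) = γ · e (𝒸 z)` with `γ ∈ Λ_𝒪ˣ`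
(the only input is H-full, PROVED here as `full_of_span` / `full_of_pins` by integrality of `Λ_𝒪 = Σ_j Λ·C(bO_j)` over `Λ`). Hence station (R)
— and EV-C, and every statement of the shape `∃ ν ≠ 0, w ∈ Λ_𝒪ˣ, P (C ν · w · e(𝒸 z))` — is GAUGE-INVARIANT (`stationR_transfer`, `evc_transfer`),
and may be proved in ONE gauge. (CG) **The coefficientwise gauge** `e_Φ` (LANDED bricks `PriceNode.exists_coeffwise_addEquiv / coeffwise_smul /
coeffwise_matrixSMul / semilinear_on_submodule / exists_equivariant_addEquiv`, station (E) `exists_trivialisation` p7206xx): `coeff_m (e_Φ t) =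
Φ⁻¹((t_i)_m)_i` for the `A`-equivariant lattice `Φ : 𝒪 ≃+ ℤ₂ⁿ`, `Φ (a b) = A a *ᵥ Φ b`, `A : 𝒪 →+* Mₙ(ℤ₂)` THE Σ_pair ring hom of Θ
(`exists_thetaMatrixRingHom_pair_smul`, LANDED). In this gauge `e_Φ` maps CONSTANT vectors to CONSTANTS (`coeffwise_const`), so k3-g26's seam
(REC) `e (κ x) = C x · e (κ 1)` (`κ x := (t₀(c′_i x))_i`) is EQUIVALENT to the `ℤ₂`-lattice statement

  FRAME(c′):  `κ (a x) = A a *ᵥ κ x`  for all `a, x ∈ 𝒪`  (⟺ `κ = Φ(· b₀)`, `b₀ := Φ⁻¹(κ 1)`; `frame_of_equivariant`, `rec_of_frame`),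

and k3-g26's (CU) is TRIVIAL: the recombinator is the constant `F = C b₀`, `b₀ ≠ 0` (`recombinator_eq_C`, `recombinatorShape_of_frame`) — no `2^a`,
no integer matrices `B(x)`, no `C ϖ`-primality, no Weierstrass. So k3-g26's sub-stubs H-full (B3), H-eqv (B4), (CU) (B6) COLLAPSE to FRAME(c′), and
FRAME(c′) is REDUCED (field trick, PROVED: `frame_mul_closed`, `frame_div_closed`, `frame_of_generator`, `frame_of_generator_pins`, with the
`ℚ₂`-coordinates lemma `exists_coords_of_finite_family`) to the pair-level consistency «BK(a) − A(a)·BK(1) = 0» of child A's (BKρ) with the LANDED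
Σ_pair at ONE formal layer point of non-zero `K`-support — i.e. FRAME(c′) is DERIVABLE from child A's clauses as they stand in the live branch
`𝒸 z ≠ 0` (sub-stub `stub_coordsEquivariant`), settling S142 without a separation hypothesis.

§A (PROVED, generic): `full_of_span`, `trivialisation_rigidity`, `evc_transfer`, `coeffwise_const`, `rec_of_frame`, `recombinator_eq_C`,
`recombinatorShape_of_frame`, `frame_of_equivariant`, `frame_mul_closed`, `frame_div_closed`, `frame_of_generator`, `exists_coords_of_finite_family`.
§B (pins `π : OnePairPins …`): PROVED `exists_eq_sum_map_mul_C` (k3-g26's H-span, re-proved), `full_of_pins` (= k3-g26's `stub_full`, now a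
theorem), `stationR_transfer` ((R) is gauge-invariant), `exists_coeffwise_gauge` (the gauge `(A, Φ, e_Φ)` at the pins with ALL its clauses:
`A (ι c) = c • 1`, Σ_pair, LIN-𝒪 for `𝒸`, `Φ` `A`-equivariant and `ℤ₂`-linear, the coefficient formula, `Λ`-semilinearity, GLOBAL `Λ_𝒪`-semilinearity
of `e_Φ ∘ 𝒸`, `e_Φ (A a ⋆ t) = C a · e_Φ t`), `frame_of_generator_pins`, `rec_and_shape_of_coordsEquivariant` (FRAME ⟹ (REC) ∧ (CU) in the gauge);
sub-stubs (sorry): `stub_coordsEquivariant` (FRAME(c′) from `KatoValuedClass` in the live branch), `stub_scaledColumnValues_coeffwise` is NOT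
restated here — the TOP remains k3-g26's `stub_scaledColumnValues_of_katoValuedClass` (EV-C(2^a q)), to be proved in the gauge `e_Φ` (where
`a = 0`, (REC)/(CU) are the theorems above) and transported to every `e` by `evc_transfer` + `trivialisation_rigidity`.

References: [Kato2004Asterisque] Thm. 12.5 (1) (pp. 221–222), §13.8 (pp. 228–229), §14.9 (p. 239); [Kobayashi2003] Thm. 6.2, (8.23)–(8.26);
[Washington1997] §7.1, §13.2; [Lang1990] Ch. 5 §1; [AtiyahMacdonald1969] Prop. 5.1 / Cor. 5.4 (integrality of a finite algebra).
-/

set_option autoImplicit false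
set_option linter.dupNamespace false
set_option backward.isDefEq.respectTransparency false

noncomputable section

open scoped Classical NumberField

namespace Summit.BirchSwinnertonDyer.BirchSwinnertonDyer.Cruxes.ResidualThetaCountLowerPureAtTwo.SideaK3G27

open Matrix

/-! ## §A Generic kernel algebra (PROVED) -/

section Generic

variable {A O : Type*} [CommRing A] [CommRing O] {n : ℕ}

/-- **H-full from a finite `Λ`-spanning family (k3-g26's `stub_full`, now a theorem).** If `Λ_O = O⟦X⟧` is spanned over `Λ = A⟦X⟧` (through
`map ι`) by finitely many constants `C (b j)`, then every `V ≠ 0` has a non-zero `Λ`-multiple of ANY `t` inside `Λ_O · V`: `V` is integral over `Λ`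
(finite algebra), and a non-zero coefficient of a polynomial relation of `V` lies in `(V) ∩ Λ`. [cite: AtiyahMacdonald1969, Prop. 5.1] -/
theorem full_of_span [Nontrivial A] [IsDomain O] (ι : A →+* O) {N : ℕ} (b : Fin N → O)
    (hspan : ∀ s : PowerSeries O, ∃ r : Fin N → PowerSeries A, s = ∑ j, PowerSeries.map ι (r j) * PowerSeries.C (b j))
    (V : PowerSeries O) (hV : V ≠ 0) (t : PowerSeries O) :
    ∃ r : PowerSeries A, r ≠ 0 ∧ ∃ s : PowerSeries O, PowerSeries.map ι r * t = s * V := by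
  letI alg : Algebra (PowerSeries A) (PowerSeries O) := (PowerSeries.map ι).toAlgebra
  have halg : ∀ r : PowerSeries A, algebraMap (PowerSeries A) (PowerSeries O) r = PowerSeries.map ι r := fun _ => rfl
  haveI : Module.Finite (PowerSeries A) (PowerSeries O) := by
    refine Module.finite_def.mpr ⟨Finset.univ.image (fun j => PowerSeries.C (b j)), ?_⟩
    refine eq_top_iff.mpr fun s _ => ?_
    obtain ⟨r, hr⟩ := hspan s
    rw [hr]
    refine Submodule.sum_mem _ fun j _ => ?_
    have hmem : PowerSeries.C (b j) ∈ Submodule.span (PowerSeries A)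
        (↑(Finset.univ.image (fun j => PowerSeries.C (b j))) : Set (PowerSeries O)) :=
      Submodule.subset_span (Finset.mem_coe.mpr (Finset.mem_image_of_mem (fun j => PowerSeries.C (b j)) (Finset.mem_univ j)))
    have hsm := Submodule.smul_mem _ (r j) hmem
    rwa [Algebra.smul_def, halg] at hsm
  have hint : IsIntegral (PowerSeries A) V := Algebra.IsIntegral.isIntegral V
  obtain ⟨p, hp, hpV⟩ := hint
  have hne : (Ideal.span {V}).comap (algebraMap (PowerSeries A) (PowerSeries O)) ≠ ⊥ :=
    Ideal.comap_ne_bot_of_root_mem hV (Ideal.mem_span_singleton_self V) hp.ne_zero hpV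
  obtain ⟨r, hr, hr0⟩ := Submodule.exists_mem_ne_zero_of_ne_bot hne
  rw [Ideal.mem_comap, halg, Ideal.mem_span_singleton'] at hr
  obtain ⟨s, hs⟩ := hr
  exact ⟨r, hr0, s * t, by rw [← hs]; ring⟩

/-- **(TR) Trivialisation rigidity.** Two additive `Λ`-semilinear trivialisations `e, e′ : Λⁿ ≃+ Λ_O` that are both `Λ_O`-semilinear along the
column family of ONE class `z` (`e (𝒸 (s • z)) = s · e (𝒸 z)`) differ ON `𝒸 z` by a UNIT of `Λ_O`: `e′ (𝒸 z) = γ · e (𝒸 z)`, `γ = e′(e⁻¹ 1) ∈ Λ_Oˣ`.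
Proof: `g := e′ ∘ e⁻¹` is `Λ`-linear and `Λ_O`-linear on `Λ_O · V` (`V := e (𝒸 z)`); H-full moves every `t` into `Λ_O · V` up to a non-zero
`Λ`-scalar, so `g(t) · V = t · g(V) = t · V′`; at `t = 1` and `t = g⁻¹(1)` this gives `V′ = g(1) V`, `V = g⁻¹(1)… V′`, whence `g(1)` is a unit.
[cite: Washington1997, §13.2] [cite: Kato2004Asterisque, Thm. 12.5 (1) (p. 221)] -/
theorem trivialisation_rigidity [IsDomain O] (ι : A →+* O) (hι : Function.Injective ι)
    {H : Type*} [AddCommGroup H] [Module (PowerSeries O) H] (cv : H → (Fin n → PowerSeries A)) (z : H)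
    (e e' : (Fin n → PowerSeries A) ≃+ PowerSeries O)
    (he : ∀ (r : PowerSeries A) (t : Fin n → PowerSeries A), e (r • t) = PowerSeries.map ι r * e t)
    (he' : ∀ (r : PowerSeries A) (t : Fin n → PowerSeries A), e' (r • t) = PowerSeries.map ι r * e' t)
    (hlin : ∀ s : PowerSeries O, e (cv (s • z)) = s * e (cv z))
    (hlin' : ∀ s : PowerSeries O, e' (cv (s • z)) = s * e' (cv z))
    (hfull : e (cv z) ≠ 0 → ∀ t : PowerSeries O, ∃ r : PowerSeries A, r ≠ 0 ∧ ∃ s : PowerSeries O,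
      PowerSeries.map ι r * t = s * e (cv z)) :
    ∃ γ : PowerSeries O, IsUnit γ ∧ e' (cv z) = γ * e (cv z) := by
  by_cases hV : e (cv z) = 0
  · have hz : cv z = 0 := e.injective (by rw [hV, map_zero])
    exact ⟨1, isUnit_one, by rw [hz, map_zero, map_zero, mul_zero]⟩
  have hg_smul : ∀ (r : PowerSeries A) (t : PowerSeries O),
      e' (e.symm (PowerSeries.map ι r * t)) = PowerSeries.map ι r * e' (e.symm t) := fun r t => by
    have h1 : e.symm (PowerSeries.map ι r * t) = r • e.symm t :=
      e.injective (by rw [e.apply_symm_apply, he, e.apply_symm_apply])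
    rw [h1, he']
  have hg_lin : ∀ s : PowerSeries O, e' (e.symm (s * e (cv z))) = s * e' (cv z) := fun s => by
    rw [← hlin s, e.symm_apply_apply, hlin' s]
  have hkey : ∀ t : PowerSeries O, e' (e.symm t) * e (cv z) = t * e' (cv z) := fun t => by
    obtain ⟨r, hr, s, hs⟩ := hfull hV t
    have hr' : PowerSeries.map ι r ≠ 0 := fun h =>
      hr (PowerSeries.map_injective ι hι (by rw [h, map_zero]))
    have h1 : PowerSeries.map ι r * e' (e.symm t) = s * e' (cv z) := by rw [← hg_smul, hs, hg_lin]
    refine mul_left_cancel₀ hr' ?_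
    calc PowerSeries.map ι r * (e' (e.symm t) * e (cv z))
        = (PowerSeries.map ι r * e' (e.symm t)) * e (cv z) := by ring
      _ = s * e' (cv z) * e (cv z) := by rw [h1]
      _ = (s * e (cv z)) * e' (cv z) := by ring
      _ = PowerSeries.map ι r * t * e' (cv z) := by rw [← hs]
      _ = PowerSeries.map ι r * (t * e' (cv z)) := by ring
  have h1 : e' (cv z) = e' (e.symm 1) * e (cv z) := by
    have h := hkey 1
    rw [one_mul] at h
    exact h.symm
  have h2 : e (cv z) = e (e'.symm 1) * e' (cv z) := by
    have h := hkey (e (e'.symm 1))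
    rw [e.symm_apply_apply, e'.apply_symm_apply, one_mul] at h
    exact h
  have h3 : e (e'.symm 1) * e' (e.symm 1) * e (cv z) = 1 * e (cv z) := by
    rw [mul_assoc, ← h1, one_mul]
    exact h2.symm
  have h4 : e (e'.symm 1) * e' (e.symm 1) = 1 := mul_right_cancel₀ hV h3
  exact ⟨e' (e.symm 1), IsUnit.of_mul_eq_one (e (e'.symm 1)) (by rw [mul_comm]; exact h4), h1⟩

/-- **Gauge transport of EV-C-shaped statements.** A statement `∃ a, ν ≠ 0, w₁ ∈ Λ_Oˣ, P a (C ν · w₁ · V)` about `V = e (𝒸 z)` passes to any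
`V′ = γ · V`, `γ ∈ Λ_Oˣ` (`w₁ ↦ w₁ γ⁻¹`): with (TR), k3-g26's TOP `stub_scaledColumnValues_of_katoValuedClass` need only be proved in ONE gauge.
[cite: Kato2004Asterisque, Thm. 12.5 (1) (p. 221)] -/
theorem evc_transfer {Λ : Type*} [CommRing Λ] {O' : Type*} [Zero O'] (cst : O' → Λ) (V V' γ : Λ) (hγ : IsUnit γ) (hV' : V' = γ * V)
    (P : ℕ → Λ → Prop) (h : ∃ (a : ℕ) (ν : O') (w₁ : Λ), ν ≠ 0 ∧ IsUnit w₁ ∧ P a (cst ν * w₁ * V)) :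
    ∃ (a : ℕ) (ν : O') (w₁ : Λ), ν ≠ 0 ∧ IsUnit w₁ ∧ P a (cst ν * w₁ * V') := by
  obtain ⟨a, ν, w₁, hν, hw₁, hP⟩ := h
  obtain ⟨u, rfl⟩ := hγ
  refine ⟨a, ν, w₁ * ↑u⁻¹, hν, hw₁.mul (Units.isUnit u⁻¹), ?_⟩
  have hVV : cst ν * (w₁ * ↑u⁻¹) * V' = cst ν * w₁ * V := by
    rw [hV', mul_assoc (cst ν) w₁, mul_assoc (cst ν), mul_assoc w₁, ← mul_assoc (↑u⁻¹ : Λ) (↑u : Λ), Units.inv_mul, one_mul]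
  rw [hVV]
  exact hP

/-- **The coefficientwise gauge maps constant vectors to constants**: `e_Φ (C ∘ v) = C (Φ⁻¹ v)`. [cite: Washington1997, §7.1] -/
theorem coeffwise_const (Φ : O ≃+ (Fin n → A)) (e : (Fin n → PowerSeries A) ≃+ PowerSeries O)
    (heΦ : ∀ (t : Fin n → PowerSeries A) (m : ℕ), PowerSeries.coeff m (e t) = Φ.symm fun i => PowerSeries.coeff m (t i))
    (v : Fin n → A) : e (fun i => PowerSeries.C (v i)) = PowerSeries.C (Φ.symm v) := by
  ext m
  rw [heΦ, PowerSeries.coeff_C]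
  by_cases hm : m = 0
  · subst hm
    rw [if_pos rfl]
    congr 1
    funext i
    exact PowerSeries.coeff_zero_C (v i)
  · rw [if_neg hm]
    have h0 : (fun i => PowerSeries.coeff m (PowerSeries.C (v i))) = 0 := by
      funext i
      rw [PowerSeries.coeff_C, if_neg hm, Pi.zero_apply]
    rw [h0, map_zero]

/-- **FRAME from `A`-equivariance**: if `κ (a x) = A a *ᵥ κ x` and `Φ (a b) = A a *ᵥ Φ b`, then `κ = Φ (· b₀)` with `b₀ := Φ⁻¹ (κ 1)`.
[cite: Kato2004Asterisque, §13.8 (p. 228)] -/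
theorem frame_of_equivariant (Am : O →+* Matrix (Fin n) (Fin n) A) (Φ : O ≃+ (Fin n → A))
    (hΦA : ∀ a b : O, Φ (a * b) = (Am a) *ᵥ (Φ b)) (κ : O → Fin n → A)
    (hκA : ∀ a x : O, κ (a * x) = (Am a) *ᵥ (κ x)) : ∃ b₀ : O, ∀ x, κ x = Φ (x * b₀) :=
  ⟨Φ.symm (κ 1), fun x => by rw [hΦA, Φ.apply_symm_apply, ← hκA, mul_one]⟩

/-- **(REC) in the coefficientwise gauge from FRAME**: `e_Φ (κ x) = C x · e_Φ (κ 1)` once `κ = Φ(· b₀)` — both sides are the constant `C (x b₀)`.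
[cite: Kato2004Asterisque, Thm. 12.5 (1) (pp. 221–222)] -/
theorem rec_of_frame (Φ : O ≃+ (Fin n → A)) (e : (Fin n → PowerSeries A) ≃+ PowerSeries O)
    (heΦ : ∀ (t : Fin n → PowerSeries A) (m : ℕ), PowerSeries.coeff m (e t) = Φ.symm fun i => PowerSeries.coeff m (t i))
    (κ : O → Fin n → A) (b₀ : O) (hκ : ∀ x, κ x = Φ (x * b₀)) :
    ∀ x : O, e (fun i => PowerSeries.C (κ x i)) = PowerSeries.C x * e (fun i => PowerSeries.C (κ 1 i)) := by
  intro x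
  rw [coeffwise_const Φ e heΦ (κ x), coeffwise_const Φ e heΦ (κ 1), hκ x, hκ 1, Φ.symm_apply_apply, Φ.symm_apply_apply,
    one_mul, ← map_mul]

/-- **(CU) is trivial in the coefficientwise gauge**: the recombinator `F := e_Φ (κ 1)` IS the constant `C b₀`. [cite: Washington1997, §7.1] -/
theorem recombinator_eq_C (Φ : O ≃+ (Fin n → A)) (e : (Fin n → PowerSeries A) ≃+ PowerSeries O)
    (heΦ : ∀ (t : Fin n → PowerSeries A) (m : ℕ), PowerSeries.coeff m (e t) = Φ.symm fun i => PowerSeries.coeff m (t i))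
    (κ : O → Fin n → A) (b₀ : O) (hκ : ∀ x, κ x = Φ (x * b₀)) :
    e (fun i => PowerSeries.C (κ 1 i)) = PowerSeries.C b₀ := by
  rw [coeffwise_const Φ e heΦ (κ 1), hκ 1, one_mul, Φ.symm_apply_apply]

/-- **(CU) in k3-g26's registered shape** (`∃ f₀ ≠ 0, w₀ ∈ Λ_Oˣ, F = C f₀ · w₀`) in the coefficientwise gauge, from FRAME and (ND) (`κ` injective ⇒
`b₀ ≠ 0`); `w₀ = 1`. [cite: Washington1997, §7.1] -/
theorem recombinatorShape_of_frame [Nontrivial O] (Φ : O ≃+ (Fin n → A)) (e : (Fin n → PowerSeries A) ≃+ PowerSeries O)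
    (heΦ : ∀ (t : Fin n → PowerSeries A) (m : ℕ), PowerSeries.coeff m (e t) = Φ.symm fun i => PowerSeries.coeff m (t i))
    (κ : O → Fin n → A) (hinj : Function.Injective κ) (b₀ : O) (hκ : ∀ x, κ x = Φ (x * b₀)) :
    ∃ (f₀ : O) (w₀ : PowerSeries O), f₀ ≠ 0 ∧ IsUnit w₀ ∧ e (fun i => PowerSeries.C (κ 1 i)) = PowerSeries.C f₀ * w₀ := by
  refine ⟨b₀, 1, fun h0 => ?_, isUnit_one, by rw [recombinator_eq_C Φ e heΦ κ b₀ hκ, mul_one]⟩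
  have h10 : κ 1 = κ 0 := by rw [hκ, hκ, h0, mul_zero, mul_zero]
  exact one_ne_zero (hinj h10)

/-- **Field trick, step 1**: the frame set `{y | ∀ a, κ (a y) = A a *ᵥ κ y}` is closed under multiplication by `O` (`A` multiplicative).
[cite: Kato2004Asterisque, §13.8 (p. 228)] -/
theorem frame_mul_closed (Am : O →+* Matrix (Fin n) (Fin n) A) (κ : O → Fin n → A) (y : O)
    (hy : ∀ a : O, κ (a * y) = (Am a) *ᵥ (κ y)) (a' : O) : ∀ a : O, κ (a * (a' * y)) = (Am a) *ᵥ (κ (a' * y)) := by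
  intro a
  calc κ (a * (a' * y)) = κ ((a * a') * y) := by rw [mul_assoc]
    _ = (Am (a * a')) *ᵥ (κ y) := hy _
    _ = (Am a * Am a') *ᵥ (κ y) := by rw [map_mul]
    _ = (Am a) *ᵥ ((Am a') *ᵥ (κ y)) := by rw [Matrix.mulVec_mulVec]
    _ = (Am a) *ᵥ (κ (a' * y)) := by rw [← hy a']

/-- **Field trick, step 2**: the frame set is closed under division by non-zero `ι c` (`κ` `ι`-linear, `A` a domain). [cite: Lang1990, Ch. 5 §1] -/
theorem frame_div_closed [IsDomain A] (ι : A →+* O) (Am : O →+* Matrix (Fin n) (Fin n) A) (κ : O → Fin n → A)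
    (hκι : ∀ (c : A) (y : O), κ (ι c * y) = c • κ y) (c : A) (hc : c ≠ 0) (y : O)
    (hy : ∀ a : O, κ (a * (ι c * y)) = (Am a) *ᵥ (κ (ι c * y))) : ∀ a : O, κ (a * y) = (Am a) *ᵥ (κ y) := by
  intro a
  have h := hy a
  rw [mul_left_comm, hκι, hκι, Matrix.mulVec_smul] at h
  exact smul_right_injective (Fin n → A) hc h

/-- **Field trick, conclusion**: FRAME at ONE `y₀` that generates `K = Frac O` over `O[1/ι]` (`ι c · x ∈ O · y₀` for some `c ≠ 0`, every `x`) gives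
FRAME everywhere. [cite: Lang1990, Ch. 5 §1] -/
theorem frame_of_generator [IsDomain A] (ι : A →+* O) (Am : O →+* Matrix (Fin n) (Fin n) A) (κ : O → Fin n → A)
    (hκι : ∀ (c : A) (y : O), κ (ι c * y) = c • κ y) (y₀ : O) (hy₀ : ∀ a : O, κ (a * y₀) = (Am a) *ᵥ (κ y₀))
    (hgen : ∀ x : O, ∃ (c : A) (a' : O), c ≠ 0 ∧ ι c * x = a' * y₀) :
    ∀ a x : O, κ (a * x) = (Am a) *ᵥ (κ x) := by
  intro a x
  obtain ⟨c, a', hc, hx⟩ := hgen x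
  have h1 : ∀ a : O, κ (a * (ι c * x)) = (Am a) *ᵥ (κ (ι c * x)) := by
    rw [hx]
    exact frame_mul_closed Am κ y₀ hy₀ a'
  exact frame_div_closed ι Am κ hκι c hc x h1 a

/-- **`𝕜`-coordinates of a finite family** (the bookkeeping behind «BK(a) − A(a)·BK(1) = 0 ⟹ FRAME on the `K`-support»): finitely many vectors of a
`𝕜`-space are `𝕜`-combinations of a `𝕜`-INDEPENDENT finite family (a basis of their span). [folklore; Mathlib `Module.finBasis`] -/
theorem exists_coords_of_finite_family {𝕜 L : Type*} [Field 𝕜] [AddCommGroup L] [Module 𝕜 L] {N : ℕ} (G : Fin N → L) :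
    ∃ (m : ℕ) (ε : Fin m → L) (g : Fin N → Fin m → 𝕜),
      (∀ k, G k = ∑ l, g k l • ε l) ∧ ∀ c : Fin m → 𝕜, ∑ l, c l • ε l = 0 → c = 0 := by
  haveI : FiniteDimensional 𝕜 (Submodule.span 𝕜 (Set.range G)) := FiniteDimensional.span_of_finite 𝕜 (Set.finite_range G)
  let b := Module.finBasis 𝕜 (Submodule.span 𝕜 (Set.range G))
  have hG : ∀ k, G k ∈ Submodule.span 𝕜 (Set.range G) := fun k => Submodule.subset_span ⟨k, rfl⟩
  refine ⟨Module.finrank 𝕜 (Submodule.span 𝕜 (Set.range G)), fun l => (b l : L), fun k l => b.repr ⟨G k, hG k⟩ l, fun k => ?_,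
    fun c hc => ?_⟩
  · have h := congrArg (Submodule.subtype (Submodule.span 𝕜 (Set.range G))) (b.sum_repr ⟨G k, hG k⟩)
    rw [map_sum] at h
    simp only [map_smul, Submodule.subtype_apply] at h
    exact h.symm
  · have h0 : ∑ l, c l • b l = 0 := by
      apply (Submodule.span 𝕜 (Set.range G)).injective_subtype
      rw [map_sum, map_zero]
      simp only [map_smul, Submodule.subtype_apply]
      exact hc
    funext l
    exact Fintype.linearIndependent_iff.mp b.linearIndependent c h0 l

end Generic

/-! ## §B At the pins `π : OnePairPins …` -/

section Pins

open Summit.BirchSwinnertonDyer.BirchSwinnertonDyer.Theorems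
open Summit.BirchSwinnertonDyer.BirchSwinnertonDyer.Theorems.OnePair
open Summit.BirchSwinnertonDyer.BirchSwinnertonDyer.Theorems.ThetaTransport
open Literature.NumberTheory.EllipticCurves Literature.NumberTheory.EllipticCurves.GreenbergSelmer
open Literature.NumberTheory.GaloisRepresentations NumberField IsDedekindDomain Field
open GreenbergVatsal2000 Kobayashi2003 Rat.HeightOneSpectrum PowerSeries
open Literature.NumberTheory.EllipticCurves.FormalGroupChart
open Literature.NumberTheory.EllipticCurves.Sprung2012 Literature.NumberTheory.EllipticCurves.Rank1Residual
open Summit.BirchSwinnertonDyer.Rank1Residual.Additive Summit.BirchSwinnertonDyer.Rank1Residual.Additive.PadicCyclotomicTower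
  Summit.BirchSwinnertonDyer.Rank1Residual.Additive.BallEval
open Summit.BirchSwinnertonDyer.BirchSwinnertonDyer.Theorems.SignedKatoOffTwo
  Summit.BirchSwinnertonDyer.BirchSwinnertonDyer.Theorems.SignedKatoOffTwo.LocalTwo

variable {S : Set (PadicAlgCl 2)} {W : WeierstrassCurve ℚ} [W.IsElliptic] {κ : ZpExtension ℚ 2} {γ : absoluteGaloisGroup ℚ}
  {S₀ : Finset (HeightOneSpectrum (𝓞 ℚ))} {n : ℕ} {ρ : FramedGaloisRep ℚ ↥(padicCoeffIntegers S) 2}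
  {Θ : ∀ v : HeightOneSpectrum (𝓞 ℚ), ((2 : ℕ) : 𝓞 ℚ) ∈ v.asIdeal → (Cofree ρ ↥(padicCoeffField S) ≃+ (Fin n → ↥(W.geomPrimaryTorsion 2)))}
  {hΘ : ∀ v hv (δ : absoluteGaloisGroup (v.adicCompletion ℚ)) m i,
    Θ v hv (resGalOfEmb (closureEmb (K := ℚ) (v.adicCompletion ℚ)) δ • m) i = resGalOfEmb (closureEmb (K := ℚ) (v.adicCompletion ℚ)) δ • Θ v hv m i}
  {I : Kato2004.IwasawaH1DataCoeff (FramedGaloisRep.toGaloisRep ρ) 2 κ γ}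
  {Sg : AddSubgroup (subgroupH1 κ.kerSubgroup (Cofree ρ ↥(padicCoeffField S)))} [Module ↥(padicCoeffIntegers S) ↥Sg]
  (π : OnePairPins S W κ γ S₀ n ρ Θ hΘ I Sg)

omit [W.IsElliptic] in
/-- `ℤ₂ ↪ 𝒪` is injective (k3-g26, re-proved). [folklore] -/
theorem padicIntToCoeffIntegers_injective : Function.Injective (padicIntToCoeffIntegers S) := by
  intro a b h
  have h' := congrArg (fun x : ↥(padicCoeffIntegers S) => (x : PadicAlgCl 2)) h
  simp only [coe_padicIntToCoeffIntegers] at h'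
  exact Subtype.ext ((algebraMap ℚ_[2] (PadicAlgCl 2)).injective h')

/-- **H-span (k3-g26, re-proved from the pin `hbO`)**: every `s ∈ Λ_𝒪` is `Σ_j (map ι r_j) · C(bO_j)`. [cite: Kato2004Asterisque, §14.9 (p. 239)] -/
theorem exists_eq_sum_map_mul_C (s : IwasawaAlgebraO S) :
    ∃ r : Fin π.nb → PowerSeries ℤ_[2], s = ∑ j, PowerSeries.map (padicIntToCoeffIntegers S) (r j) * PowerSeries.C (π.bO j) := by
  refine ⟨fun j => PowerSeries.mk fun k => π.t₀ (PowerSeries.coeff k s * π.bO' j), PowerSeries.ext fun k => ?_⟩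
  rw [map_sum]
  exact (π.hbO _).trans (Finset.sum_congr rfl fun j _ => by
    rw [PowerSeries.coeff_mul_C, PowerSeries.coeff_map, PowerSeries.coeff_mk])

include π in
/-- **H-full at the pins — k3-g26's sub-stub `stub_full` is a THEOREM** (and needs no `FiniteDimensional` instance): `full_of_span` on the
`bO`-spanning family. [cite: Washington1997, §13.2] [cite: AtiyahMacdonald1969, Prop. 5.1] -/
theorem full_of_pins (V : IwasawaAlgebraO S) (hV : V ≠ 0) (t : IwasawaAlgebraO S) :
    ∃ r : PowerSeries ℤ_[2], r ≠ 0 ∧ ∃ s : IwasawaAlgebraO S, PowerSeries.map (padicIntToCoeffIntegers S) r * t = s * V :=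
  full_of_span (padicIntToCoeffIntegers S) π.bO (exists_eq_sum_map_mul_C π) V hV t

/-- **Station (R) is GAUGE-INVARIANT** (TR at the pins): if `C ν · e (𝒸 z) = μt · Lm · u` (`ν ≠ 0`, `u ≠ 0`) for ONE trivialisation `e` that is
`Λ`-semilinear and `Λ_𝒪`-semilinear on `Λ_𝒪 z`, then the same holds (same `ν`, `u ↦ u γ`) for EVERY such `e′` — so the registered
`stub_kzgValueRelation` / k3-g26's TOP need only be proved in the coefficientwise gauge of `exists_coeffwise_gauge`.
[cite: Kato2004Asterisque, Thm. 12.5 (1) (p. 221)] [cite: Washington1997, §13.2] -/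
theorem stationR_transfer (z : I.H) (μt Lm : IwasawaAlgebraO S) (e e' : (Fin n → PowerSeries ℤ_[2]) ≃+ IwasawaAlgebraO S)
    (he : ∀ (r : PowerSeries ℤ_[2]) (t : Fin n → PowerSeries ℤ_[2]), e (r • t) = PowerSeries.map (padicIntToCoeffIntegers S) r * e t)
    (he' : ∀ (r : PowerSeries ℤ_[2]) (t : Fin n → PowerSeries ℤ_[2]), e' (r • t) = PowerSeries.map (padicIntToCoeffIntegers S) r * e' t)
    (hlin : ∀ (s : IwasawaAlgebraO S) (x : I.H), x ∈ Submodule.span (IwasawaAlgebraO S) ({z} : Set I.H) →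
      e (π.cvec (s • x)) = s * e (π.cvec x))
    (hlin' : ∀ (s : IwasawaAlgebraO S) (x : I.H), x ∈ Submodule.span (IwasawaAlgebraO S) ({z} : Set I.H) →
      e' (π.cvec (s • x)) = s * e' (π.cvec x))
    (hR : ∃ (ν : ↥(padicCoeffIntegers S)) (u : IwasawaAlgebraO S), ν ≠ 0 ∧ u ≠ 0 ∧
      (PowerSeries.C ν : IwasawaAlgebraO S) * e (π.cvec z) = μt * (Lm * u)) :
    ∃ (ν : ↥(padicCoeffIntegers S)) (u : IwasawaAlgebraO S), ν ≠ 0 ∧ u ≠ 0 ∧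
      (PowerSeries.C ν : IwasawaAlgebraO S) * e' (π.cvec z) = μt * (Lm * u) := by
  obtain ⟨γ', hγ', hV'⟩ := trivialisation_rigidity (padicIntToCoeffIntegers S) padicIntToCoeffIntegers_injective π.cvec z e e' he he'
    (fun s => hlin s z (Submodule.mem_span_singleton_self z)) (fun s => hlin' s z (Submodule.mem_span_singleton_self z))
    (fun hV => full_of_pins π (e (π.cvec z)) hV)
  obtain ⟨ν, u, hν, hu, hR⟩ := hR
  refine ⟨ν, u * γ', hν, mul_ne_zero hu hγ'.ne_zero, ?_⟩
  rw [hV', mul_left_comm, hR]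
  ring

set_option maxHeartbeats 800000 in
/-- **The coefficientwise gauge at the pins** (station (E) re-run with its lattice EXPOSED): THE Σ_pair ring hom `A` of `Θ`, an `A`-equivariant
`ℤ₂`-linear lattice `Φ : 𝒪 ≃+ ℤ₂ⁿ`, and the coefficientwise `e_Φ`, with: `A (ι c) = c • 1`; Σ_pair for `π.pair`; LIN-𝒪 for `𝒸 = π.cvec`;
`Φ (a b) = A a *ᵥ Φ b`; `Φ (ι c · b) = c • Φ b`; `coeff_m (e_Φ t) = Φ⁻¹ ((t_i)_m)`; `Λ`-semilinearity; GLOBAL `Λ_𝒪`-semilinearity of `e_Φ ∘ 𝒸`;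
`e_Φ (A a ⋆ t) = C a · e_Φ t`. All bricks LANDED (`exists_thetaMatrixRingHom_pair_smul`, `colTuple_locd₂_C_smul_matrix`, `exists_addEquiv_pi_fin_n`,
`PriceNode.exists_equivariant_addEquiv / htf_of_norm / exists_coeffwise_addEquiv / coeffwise_smul / coeffwise_matrixSMul / semilinear_on_submodule`,
`cvec_map_X_smul`, `exists_cvecHom`). [cite: Washington1997, §13.2, §7.1] [cite: Kato2004Asterisque, Thm. 12.5 (1) (p. 221), §13.8 (pp. 228–229)] -/
theorem exists_coeffwise_gauge [W.IsGloballyMinimal] [FiniteDimensional ℚ_[2] ↥(padicCoeffField S)] (hss : GoodSS W 2)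
    (ha2 : W.frobeniusTrace 2 = 0) (hγ : κ.IsTopGenerator γ) :
    ∃ (Am : ↥(padicCoeffIntegers S) →+* Matrix (Fin n) (Fin n) ℤ_[2]) (Φ : ↥(padicCoeffIntegers S) ≃+ (Fin n → ℤ_[2]))
      (e : (Fin n → PowerSeries ℤ_[2]) ≃+ IwasawaAlgebraO S),
      (∀ c : ℤ_[2], Am (padicIntToCoeffIntegers S c) = c • (1 : Matrix (Fin n) (Fin n) ℤ_[2])) ∧
      (∀ (a : ↥(padicCoeffIntegers S)) (m : ℕ) (y : H1 (FramedGaloisRep.toGaloisRep ρ) (κ.layerSubgroup m))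
          (Q : Fin n → ↥(localLayerPointsOfEmb κ (closureEmb (K := ℚ) (π.v.adicCompletion ℚ)) W m)),
          π.pair m (a • y) Q = ∑ i, ∑ j, Am a i j * π.pair m y (Pi.single j (Q i))) ∧
      (∀ (a : ↥(padicCoeffIntegers S)) (x : I.H),
          π.cvec ((PowerSeries.C a : IwasawaAlgebraO S) • x) = fun i => ∑ j, (PowerSeries.C (Am a i j) : PowerSeries ℤ_[2]) * π.cvec x j) ∧
      (∀ a b : ↥(padicCoeffIntegers S), Φ (a * b) = (Am a) *ᵥ (Φ b)) ∧
      (∀ (c : ℤ_[2]) (b : ↥(padicCoeffIntegers S)), Φ (padicIntToCoeffIntegers S c * b) = c • Φ b) ∧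
      (∀ (t : Fin n → PowerSeries ℤ_[2]) (m : ℕ), PowerSeries.coeff m (e t) = Φ.symm fun i => PowerSeries.coeff m (t i)) ∧
      (∀ (r : PowerSeries ℤ_[2]) (t : Fin n → PowerSeries ℤ_[2]), e (r • t) = PowerSeries.map (padicIntToCoeffIntegers S) r * e t) ∧
      (∀ (s : IwasawaAlgebraO S) (x : I.H), e (π.cvec (s • x)) = s * e (π.cvec x)) ∧
      (∀ (a : ↥(padicCoeffIntegers S)) (t : Fin n → PowerSeries ℤ_[2]),
          e (fun i => ∑ j, (PowerSeries.C (Am a i j) : PowerSeries ℤ_[2]) * t j) = (PowerSeries.C a : IwasawaAlgebraO S) * e t) := by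
  haveI : IsDiscreteValuationRing ↥(padicCoeffIntegers S) := PollackPairK.isDiscreteValuationRing_padicCoeffIntegers
  obtain ⟨Am, hAι, hPA⟩ := π.exists_thetaMatrixRingHom_pair_smul W hss ha2
  have hO : ∀ (a : ↥(padicCoeffIntegers S)) (x : I.H),
      π.cvec ((PowerSeries.C a : IwasawaAlgebraO S) • x) = fun i => ∑ j, (PowerSeries.C (Am a i j) : PowerSeries ℤ_[2]) * π.cvec x j := by
    intro a x
    have h := ThetaTransport.colTuple_locd₂_C_smul_matrix I W π.v (pair := π.pair) (locd₂ := π.locd₂) (a := a) (N := Am a) (hPA a)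
      π.hlocd₂ π.col x
    funext i
    have hi := congr_fun h i
    rw [π.cvec_apply, hi]
    exact Finset.sum_congr rfl fun j _ => by rw [PowerSeries.smul_eq_C_mul, π.cvec_apply]
  obtain ⟨B, hB⟩ := π.exists_addEquiv_pi_fin_n
  obtain ⟨Φ, hΦA, hΦι⟩ := PriceNode.exists_equivariant_addEquiv (padicIntToCoeffIntegers S) (StationE.pos_of_addEquiv_pi B) B hB Am hAι
    (PriceNode.htf_of_norm (padicIntToCoeffIntegers S) Am hAι StationE.exists_mul_eq_padicInt_pow_of_ne_zero)
  obtain ⟨𝒸, h𝒸⟩ := π.exists_cvecHom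
  have hX : ∀ x ∈ (⊤ : Submodule (IwasawaAlgebraO S) I.H),
      𝒸 ((PowerSeries.X : IwasawaAlgebraO S) • x) = (PowerSeries.X : PowerSeries ℤ_[2]) • 𝒸 x := fun x _ => by
    have h := π.cvec_map_X_smul hγ x
    rw [PowerSeries.map_X] at h
    rw [h𝒸, h𝒸, h]
  have hO' : ∀ (a : ↥(padicCoeffIntegers S)), ∀ x ∈ (⊤ : Submodule (IwasawaAlgebraO S) I.H),
      𝒸 ((PowerSeries.C a : IwasawaAlgebraO S) • x) = fun i => ∑ j, (PowerSeries.C (Am a i j) : PowerSeries ℤ_[2]) * 𝒸 x j :=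
    fun a x _ => by rw [h𝒸, h𝒸, hO a x]
  obtain ⟨e, he⟩ := PriceNode.exists_coeffwise_addEquiv (R := ℤ_[2]) Φ
  refine ⟨Am, Φ, e, hAι, hPA, hO, hΦA, hΦι, he, PriceNode.coeffwise_smul Φ e he (padicIntToCoeffIntegers S) hΦι, fun s x => ?_,
    PriceNode.coeffwise_matrixSMul Φ e he Am hΦA⟩
  have h := PriceNode.semilinear_on_submodule 𝒸 ⊤ Am Φ hΦA e he hX hO' s x Submodule.mem_top
  rw [h𝒸, h𝒸] at h
  exact h

omit [W.IsElliptic] in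
/-- **Field trick at the pins**: `𝒪` is an order (`StationE.exists_mul_eq_padicInt_pow_of_ne_zero`: `a′ y₀ = ι c`, `c ≠ 0`), so FRAME at ONE
non-zero `y₀` is FRAME everywhere. [cite: Lang1990, Ch. 5 §1] -/
theorem frame_of_generator_pins (Am : ↥(padicCoeffIntegers S) →+* Matrix (Fin n) (Fin n) ℤ_[2])
    (κ' : ↥(padicCoeffIntegers S) → Fin n → ℤ_[2])
    (hκι : ∀ (c : ℤ_[2]) (y : ↥(padicCoeffIntegers S)), κ' (padicIntToCoeffIntegers S c * y) = c • κ' y)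
    (y₀ : ↥(padicCoeffIntegers S)) (hy₀0 : y₀ ≠ 0) (hy₀ : ∀ a, κ' (a * y₀) = (Am a) *ᵥ (κ' y₀)) :
    ∀ a x, κ' (a * x) = (Am a) *ᵥ (κ' x) :=
  frame_of_generator (padicIntToCoeffIntegers S) Am κ' hκι y₀ hy₀ fun x => by
    obtain ⟨a', c, hc, h⟩ := StationE.exists_mul_eq_padicInt_pow_of_ne_zero y₀ hy₀0
    exact ⟨c, a' * x, hc, by rw [← h]; ring⟩

/-- **The Θ-coordinates `κ x := (t₀(c′_i x))_i` are `ℤ₂`-linear** (pin `ht₀`) — the `hκι` input of the field trick. [cite: Kato2004Asterisque, §14.9] -/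
theorem coords_padicInt_smul (c' : Fin n → ↥(padicCoeffIntegers S)) (c : ℤ_[2]) (y : ↥(padicCoeffIntegers S)) :
    (fun i => π.t₀ (c' i * (padicIntToCoeffIntegers S c * y))) = c • (fun i => π.t₀ (c' i * y)) := by
  funext i
  rw [Pi.smul_apply, smul_eq_mul, mul_left_comm, π.ht₀]

/-- **FRAME ⟹ (REC) ∧ (CU) in the coefficientwise gauge** (PROVED glue): k3-g26's `hrec` input of `columnValue_eq_of_coordSum_of_rec` /
`recombination_of_cvecEquivariance` AND its sub-stub `stub_recombinatorShape`, both from FRAME(c′) alone once `e = e_Φ`.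
[cite: Kato2004Asterisque, Thm. 12.5 (1) (pp. 221–222)] [cite: Washington1997, §7.1] -/
theorem rec_and_shape_of_coordsEquivariant (c' : Fin n → ↥(padicCoeffIntegers S)) (hc : π.CoordNondeg c')
    (Am : ↥(padicCoeffIntegers S) →+* Matrix (Fin n) (Fin n) ℤ_[2]) (Φ : ↥(padicCoeffIntegers S) ≃+ (Fin n → ℤ_[2]))
    (hΦA : ∀ a b : ↥(padicCoeffIntegers S), Φ (a * b) = (Am a) *ᵥ (Φ b)) (e : (Fin n → PowerSeries ℤ_[2]) ≃+ IwasawaAlgebraO S)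
    (heΦ : ∀ (t : Fin n → PowerSeries ℤ_[2]) (m : ℕ), PowerSeries.coeff m (e t) = Φ.symm fun i => PowerSeries.coeff m (t i))
    (hfr : ∀ a x : ↥(padicCoeffIntegers S), (fun i => π.t₀ (c' i * (a * x))) = (Am a) *ᵥ (fun i => π.t₀ (c' i * x))) :
    (∀ x : ↥(padicCoeffIntegers S), e (fun i => PowerSeries.C (π.t₀ (c' i * x))) =
        (PowerSeries.C x : IwasawaAlgebraO S) * e (fun i => PowerSeries.C (π.t₀ (c' i * 1)))) ∧
    ∃ (f₀ : ↥(padicCoeffIntegers S)) (w₀ : IwasawaAlgebraO S), f₀ ≠ 0 ∧ IsUnit w₀ ∧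
        e (fun i => PowerSeries.C (π.t₀ (c' i * 1))) = (PowerSeries.C f₀ : IwasawaAlgebraO S) * w₀ := by
  obtain ⟨b₀, hb₀⟩ := frame_of_equivariant Am Φ hΦA (fun x i => π.t₀ (c' i * x)) hfr
  exact ⟨rec_of_frame Φ e heΦ (fun x i => π.t₀ (c' i * x)) b₀ hb₀,
    recombinatorShape_of_frame Φ e heΦ (fun x i => π.t₀ (c' i * x)) hc b₀ hb₀⟩

/-- **Sub-stub FRAME(c′) (M; the ONE residual node of the S-layer, print-adjacent).** In the live branch `𝒸 z ≠ 0`, the Θ-coordinates of a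
`KatoValuedClass` witness are `A`-EQUIVARIANT: `κ (a x) = A a *ᵥ κ x`. Plan (field trick, all glue PROVED above): (BKρ) at `a` and at `1` for the
SAME formal layer point `Q`, compared through Σ_pair (`hPA`) and `I.proj_C_smul`, give `Σ_k [κ(a bO_k) − A a *ᵥ κ(bO_k)]_i · G_k(Q) = 0` in `ℚ̄₂`
(`G_k(Q) := Σ_b τ_b • (log_Ω(Q) · w_k)`); `exists_coords_of_finite_family` (over `ℚ₂`) turns this into FRAME at the `K`-support vectors
`y_l(Q) := Σ_k g_{kl} bO_k` (scaled into `𝒪`); one `y_l(Q) ≠ 0` suffices (`frame_of_generator_pins`, `coords_padicInt_smul`), and if ALL vanish at ALL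
formal layer points then every `ℓ_i = Σ_l t₀(c′_i y_l) ε_l` vanishes there, i.e. (`hcol_ker`, `[3]` on `Ê`) `𝒸 z = 0` — excluded. Why it may fail: the
cast bookkeeping `ℤ₂ → ℚ₂ → ℚ̄₂` of (BKρ) and the passage «`ℓ_i = 0` on formal layer points ⟹ `col ℓ_i = 0`» (needs `Ê(𝔪) ⊇ 3·E(ℚ_{m,v})` at
supersingular `a₂ = 0`, TP2 `LocalTwoLayerTorsion`). [cite: Kato2004Asterisque, Thm. 12.5 (1) (pp. 221–222), §13.8 (p. 228)]
[cite: Kobayashi2003, Thm. 6.2, (8.23)] -/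
theorem stub_coordsEquivariant [W.IsGloballyMinimal] {M : ℕ} [NeZero M] (g : CuspForm (CongruenceSubgroup.Gamma0 M) 2)
    (ι : ModularForms.coeffField g →+* PadicAlgCl 2) (Ω : ℂ) (F : π.KatoFrame) (z : I.H)
    (c' : Fin n → ↥(padicCoeffIntegers S)) (w : ℕ → Fin π.nb → PadicAlgCl 2) (q : PadicAlgCl 2) (μt : IwasawaAlgebraO S)
    (hK : π.KatoValuedClass g ι Ω F.Φ F.τ z c' w q μt) (hz : π.cvec z ≠ 0)
    (Am : ↥(padicCoeffIntegers S) →+* Matrix (Fin n) (Fin n) ℤ_[2])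
    (hAι : ∀ c : ℤ_[2], Am (padicIntToCoeffIntegers S c) = c • (1 : Matrix (Fin n) (Fin n) ℤ_[2]))
    (hPA : ∀ (a : ↥(padicCoeffIntegers S)) (m : ℕ) (y : H1 (FramedGaloisRep.toGaloisRep ρ) (κ.layerSubgroup m))
        (Q : Fin n → ↥(localLayerPointsOfEmb κ (closureEmb (K := ℚ) (π.v.adicCompletion ℚ)) W m)),
        π.pair m (a • y) Q = ∑ i, ∑ j, Am a i j * π.pair m y (Pi.single j (Q i))) :
    ∀ a x : ↥(padicCoeffIntegers S), (fun i => π.t₀ (c' i * (a * x))) = (Am a) *ᵥ (fun i => π.t₀ (c' i * x)) := by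
  sorry

/-- **PROVED GLUE «one gauge suffices» for k3-g26's TOP** (`stub_scaledColumnValues_of_katoValuedClass`, EV-C(2^a q)): if the scaled-column-value
display holds for every GLOBALLY `Λ_𝒪`-semilinear COEFFICIENTWISE trivialisation (the gauge of `exists_coeffwise_gauge`, where (REC)/(CU) are the
theorems above), then it holds for EVERY `Λ`-semilinear `e` that is `Λ_𝒪`-semilinear on `Λ_𝒪 z` — by `trivialisation_rigidity` + `evc_transfer`.
Nothing about BSD is asserted. [cite: Kato2004Asterisque, Thm. 12.5 (1) (pp. 221–222)] [cite: Washington1997, §13.2] -/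
theorem scaledColumnValues_of_coeffwise [W.IsGloballyMinimal] [FiniteDimensional ℚ_[2] ↥(padicCoeffField S)]
    (hss : GoodSS W 2) (ha2 : W.frobeniusTrace 2 = 0) (hγ : κ.IsTopGenerator γ)
    {M : ℕ} [NeZero M] (g : CuspForm (CongruenceSubgroup.Gamma0 M) 2)
    (ι : ModularForms.coeffField g →+* PadicAlgCl 2) (Ω : ℂ) (z : I.H) (q : PadicAlgCl 2) (μt : IwasawaAlgebraO S)
    (hgauge : ∀ (Φ : ↥(padicCoeffIntegers S) ≃+ (Fin n → ℤ_[2])) (e : (Fin n → PowerSeries ℤ_[2]) ≃+ IwasawaAlgebraO S),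
      (∀ (t : Fin n → PowerSeries ℤ_[2]) (m : ℕ), PowerSeries.coeff m (e t) = Φ.symm fun i => PowerSeries.coeff m (t i)) →
      (∀ (r : PowerSeries ℤ_[2]) (t : Fin n → PowerSeries ℤ_[2]), e (r • t) = PowerSeries.map (padicIntToCoeffIntegers S) r * e t) →
      (∀ (s : IwasawaAlgebraO S) (x : I.H), e (π.cvec (s • x)) = s * e (π.cvec x)) →
      ∃ (a : ℕ) (ν : ↥(padicCoeffIntegers S)) (w₁ : IwasawaAlgebraO S), ν ≠ 0 ∧ IsUnit w₁ ∧
        ∃ m₀ : ℕ, ∀ m : ℕ, m₀ ≤ m → ∀ ζ : ℂ_[2], IsPrimitiveRoot ζ (2 ^ (2 * m)) →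
          algebraMap (PadicAlgCl 2) ℂ_[2] ((2 : PadicAlgCl 2) ^ a * q) *
              (∑' k, ((algebraMap (PadicAlgCl 2) ℂ_[2]).comp (padicCoeffIntegers S).subtype) (PowerSeries.coeff k μt) * (ζ - 1) ^ k) *
            ((mazurTateElementK g Ω 2 (2 * m)).map ι).eval₂ (algebraMap (PadicAlgCl 2) ℂ_[2]) (ζ - 1) =
          -(((-1 : Polynomial ℤ) ^ m * cyclotomicOmegaMinus 2 (2 * m)).eval₂ (Int.castRingHom ℂ_[2]) (ζ - 1)) *
            ∑' k, ((algebraMap (PadicAlgCl 2) ℂ_[2]).comp (padicCoeffIntegers S).subtype)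
              (PowerSeries.coeff k (PowerSeries.C ν * w₁ * e (π.cvec z))) * (ζ - 1) ^ k)
    (e : (Fin n → PowerSeries ℤ_[2]) ≃+ IwasawaAlgebraO S)
    (he : ∀ (r : PowerSeries ℤ_[2]) (t : Fin n → PowerSeries ℤ_[2]), e (r • t) = PowerSeries.map (padicIntToCoeffIntegers S) r * e t)
    (hlin : ∀ (s : IwasawaAlgebraO S) (x : I.H), x ∈ Submodule.span (IwasawaAlgebraO S) ({z} : Set I.H) →
      e (π.cvec (s • x)) = s * e (π.cvec x)) :
    ∃ (a : ℕ) (ν : ↥(padicCoeffIntegers S)) (w₁ : IwasawaAlgebraO S), ν ≠ 0 ∧ IsUnit w₁ ∧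
      ∃ m₀ : ℕ, ∀ m : ℕ, m₀ ≤ m → ∀ ζ : ℂ_[2], IsPrimitiveRoot ζ (2 ^ (2 * m)) →
        algebraMap (PadicAlgCl 2) ℂ_[2] ((2 : PadicAlgCl 2) ^ a * q) *
            (∑' k, ((algebraMap (PadicAlgCl 2) ℂ_[2]).comp (padicCoeffIntegers S).subtype) (PowerSeries.coeff k μt) * (ζ - 1) ^ k) *
          ((mazurTateElementK g Ω 2 (2 * m)).map ι).eval₂ (algebraMap (PadicAlgCl 2) ℂ_[2]) (ζ - 1) =
        -(((-1 : Polynomial ℤ) ^ m * cyclotomicOmegaMinus 2 (2 * m)).eval₂ (Int.castRingHom ℂ_[2]) (ζ - 1)) *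
          ∑' k, ((algebraMap (PadicAlgCl 2) ℂ_[2]).comp (padicCoeffIntegers S).subtype)
            (PowerSeries.coeff k (PowerSeries.C ν * w₁ * e (π.cvec z))) * (ζ - 1) ^ k := by
  obtain ⟨Am, Φ, eΦ, -, -, -, -, -, heΦ, heΦs, hlinΦ, -⟩ := exists_coeffwise_gauge π hss ha2 hγ
  obtain ⟨γ', hγ', hV'⟩ := trivialisation_rigidity (padicIntToCoeffIntegers S) padicIntToCoeffIntegers_injective π.cvec z eΦ e heΦs he
    (fun s => hlinΦ s z) (fun s => hlin s z (Submodule.mem_span_singleton_self z)) (fun hV => full_of_pins π (eΦ (π.cvec z)) hV)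
  exact evc_transfer (fun ν : ↥(padicCoeffIntegers S) => (PowerSeries.C ν : IwasawaAlgebraO S)) (eΦ (π.cvec z)) (e (π.cvec z)) γ' hγ' hV'
    (fun a V => ∃ m₀ : ℕ, ∀ m : ℕ, m₀ ≤ m → ∀ ζ : ℂ_[2], IsPrimitiveRoot ζ (2 ^ (2 * m)) →
        algebraMap (PadicAlgCl 2) ℂ_[2] ((2 : PadicAlgCl 2) ^ a * q) *
            (∑' k, ((algebraMap (PadicAlgCl 2) ℂ_[2]).comp (padicCoeffIntegers S).subtype) (PowerSeries.coeff k μt) * (ζ - 1) ^ k) *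
          ((mazurTateElementK g Ω 2 (2 * m)).map ι).eval₂ (algebraMap (PadicAlgCl 2) ℂ_[2]) (ζ - 1) =
        -(((-1 : Polynomial ℤ) ^ m * cyclotomicOmegaMinus 2 (2 * m)).eval₂ (Int.castRingHom ℂ_[2]) (ζ - 1)) *
          ∑' k, ((algebraMap (PadicAlgCl 2) ℂ_[2]).comp (padicCoeffIntegers S).subtype)
            (PowerSeries.coeff k V) * (ζ - 1) ^ k)
    (hgauge Φ eΦ heΦ heΦs hlinΦ)

end Pins

end Summit.BirchSwinnertonDyer.BirchSwinnertonDyer.Cruxes.ResidualThetaCountLowerPureAtTwo.SideaK3G27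

end
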